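import Literature.AnabelianGeometry.EtaleTheta.SettingModelChiTheta
import Literature.AnabelianGeometry.EtaleTheta.SettingModelChiTwistedSections
import Literature.AnabelianGeometry.EtaleTheta.SettingModelChiSec2Hyps
import Literature.AnabelianGeometry.EtaleTheta.SettingModel2Thm16i
import Literature.AnabelianGeometry.EtaleTheta.KummerDataOfCoreSection
import Literature.AnabelianGeometry.EtaleTheta.SettingModelChiKummerData
import Literature.AnabelianGeometry.EtaleTheta.EtaleThetaDataOfClass
import HarnessLib

/-!
# The χ-twisted root model of [EtTh] §1 (R78 (B)), file F7b: Galois-section POINTS of `Ÿ` at `modelχ`,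
# the section Kummer datum (`KddHat := H¹(G_{ℚ_p}, Δ_Θ)`), `EtaleThetaData` and `NonCuspidalPoint` WITNESSED

S. Mochizuki, *The étale theta function and its Frobenioid-theoretic manifestations*, Publ. RIMS **45**
(2009) [EtTh], §1: Prop. 1.3 pp. 19–21, Prop. 1.4 (iii) p. 22 ("if … `y ∈ Ÿ(L)` is a non-cuspidal point, then
the restricted classes … `∈ H¹(G_L, Δ_Θ) ≅ (L^×)^∧`"), Prop. 1.5 p. 23 ("`F̈² = H¹(G_K̈, Δ_Θ)`"), Def. 1.9 p. 29
[cite: MochizukiEtTh2009, Prop 1.4 (iii) p.22]. Layer L2 of the abc-iut cell, seat abc-iut-L2-t6 (gen 5 draft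
part A, gen 6 parts A+B), R78 cluster hand #4, file map R100 **F7b** — over abc-iut-L2-t1's F5b
`ThetaSetting.modelχ p` (`Π^tp_X := (F̂₂ ×_Ẑ ℤ) ⋊_χ G_{ℚ_p}`, `K = ℚ_p`, `q_X = p²`, `q̈ = p`), abc-iut-w5-d171's
F6 `SettingModel.kummerCoreχ` / `kummerDataχ`, and this seat's generic layer `SettingModelChiTwistedSections`
(`sectionχ`), `KummerDataOfCoreSection` (`KummerCore.toKummerDataOfSection`, `nonCuspidalPointOfCoreSection`,
`nonCuspidalPointOfSections`) and `EtaleThetaDataOfClass` — all consumed BY NAME, nothing restated.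

PART A (section hypotheses). At `modelχ` one has `K = K̈ = K₂ = J̈₁ = ℚ_p`, so the Galois factor `inr` and
every `κ²`-twisted `b`-axis section `sectionχ (k·k)` are continuous sections of the augmentation landing in
`Π^tp_Y` (degree `0`) and in `Π^tp_Ÿ` (level-`2` `y`-coordinate even): the hypotheses `hsec`, `hsY`, `hsYdd`
of `KummerCore.toKummerDataOfSection`.

PART B (the witnesses). `kummerDataχSec p : (modelχ p).KummerData` := the SECTION Kummer datum of the core
`kummerCoreχ` along `inr` — its carrier `KddHat` is print's FULL `H¹(G_K̈, Δ_Θ)` (here `G_K̈ = G_{ℚ_p}`), the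
one on which points of `Ÿ` can be evaluated (design note F-t6g5-1); `etaleThetaDataχSec p η` := the
`EtaleThetaData` it carries for any class `η̈` (honest-degenerate `½`-groups, F7a) with `Prop13` holding;
`onePlusP p` := the unit `1 + p ∈ ℚ_p^×`, which is OFF the cusps `±q̈^ℤ = ±p^ℤ` (norms: `‖1+p‖ = 1` forces
`a = 0`, and `1 + p ≠ ±1` in characteristic `0`); **`nonCuspidalPointχ p : NonCuspidalPoint (kummerDataχSec p)`**
:= the cuspidal-direction-free Galois section `inr(G_{ℚ_p})` as `D_y` with coordinate `1 + p`, and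
`nonCuspidalPointχOfSection` := the same at ANY twisted section `sectionχ (k·k)`. CENSUS TOKENS (kernel):
`EtaleThetaData → WITNESSED at modelχ` (`nonempty_etaleThetaData_modelχ`), `NonCuspidalPoint → WITNESSED at
modelχ` (`nonempty_nonCuspidalPoint_modelχ`, for the section datum), `Prop13 → HOLDS` there.

HONEST FRAMING: SEMI-SYNTHETIC model (the χ-twisted root; not the tempered `π₁` of a curve) — consistency /
non-vacuity evidence for the typed interface ONLY; the section datum and w5-d171's `kummerDataχ` (carrier
`K̈^×`) coexist; values at section-points are not the printed `Θ̈(Ü(y))`; nothing of [EtTh] is asserted;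
typed ≠ proved; no side is taken on [IUTchIII] Cor. 3.12.
-/

noncomputable section

namespace Literature.AnabelianGeometry.EtaleTheta.SettingModel

open Literature.AnabelianGeometry.SemiGraphs _root_.Topology _root_.Function

variable (p : ℕ) [Fact p.Prime]

/-- `aug ∘ inr = id` at `modelχ`. [cite: MochizukiEtTh2009, §1 p.12] -/
theorem aug_modelχ_inr (σ : GQp p) :
    (ThetaSetting.modelχ p).aug (SemidirectProduct.inr σ) = σ := rfl

/-- `aug ∘ sectionχ f = id` at `modelχ`. [cite: MochizukiEtTh2009, §1 p.12] -/
theorem aug_modelχ_sectionχ (f : GQp p → ZH) (hf : ∀ σ τ : GQp p, f (σ * τ) = f σ * chi p σ (f τ)) (σ : GQp p) :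
    (ThetaSetting.modelχ p).aug (sectionχ p f hf σ) = σ := rfl

/-- Every twisted section lands in `Π^tp_Y = Ker(toZ)` (its `Γ`-part has degree `0`). [cite: MochizukiEtTh2009, §1 p.12] -/
theorem sectionχ_mem_GtpY_modelχ (f : GQp p → ZH) (hf : ∀ σ τ : GQp p, f (σ * τ) = f σ * chi p σ (f τ))
    (σ : GQp p) : sectionχ p f hf σ ∈ (ThetaSetting.modelχ p).GtpY := by
  change (chiTwistData p).toZ (sectionχ p f hf σ) = 1
  rw [GfpTwistData.toZ_apply, sectionχ_left, gfpSnd_bPowGfp]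

/-- `inr σ ∈ Π^tp_Y`. [cite: MochizukiEtTh2009, §1 p.12] -/
theorem inr_mem_GtpY_modelχ (σ : GQp p) : (SemidirectProduct.inr σ : PiTpχ p) ∈ (ThetaSetting.modelχ p).GtpY := by
  rw [← sectionχ_one p σ]
  exact sectionχ_mem_GtpY_modelχ p _ _ σ

/-- `Π^tp_Ÿ` of `modelχ` unfolded: `Y_2`-part and the `J̈_1`-condition on the Galois factor. [cite: MochizukiEtTh2009, §1 p.17] -/
theorem mem_GtpYdd_modelχ_iff (g : PiTpχ p) :
    g ∈ (ThetaSetting.modelχ p).GtpYdd ↔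
      g ∈ YNχ p (2 * 1) ∧ g.right ∈ (fieldJddN ⊥ (qModel p) 1).fixingSubgroup := Iff.rfl

/-- A `κ²`-twisted section lands in `Π^tp_Ÿ` of `modelχ` at EVERY `σ` (`K_2 = J̈_1 = ℚ_p`).
[cite: MochizukiEtTh2009, Def 1.9 p.29] -/
theorem sectionχ_sq_mem_GtpYdd_modelχ {k : GQp p → ZH} (hk : ∀ σ τ : GQp p, k (σ * τ) = k σ * chi p σ (k τ))
    (hkk : ∀ σ τ : GQp p, (k * k) (σ * τ) = (k * k) σ * chi p σ ((k * k) τ)) (σ : GQp p) :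
    sectionχ p (k * k) hkk σ ∈ (ThetaSetting.modelχ p).GtpYdd := by
  refine (mem_GtpYdd_modelχ_iff p _).2 ⟨?_, ?_⟩
  · rw [mul_one]
    refine sectionχ_sq_mem_YNχ_two p hk hkk σ ?_
    rw [fieldKN_bot_qModel_two, IntermediateField.fixingSubgroup_bot]
    exact Subgroup.mem_top σ
  · change σ ∈ (fieldJddN ⊥ (qModel p) 1).fixingSubgroup
    rw [fieldJddN_bot_qModel_one, IntermediateField.fixingSubgroup_bot]
    exact Subgroup.mem_top σ

/-- `inr σ ∈ Π^tp_Ÿ` of `modelχ` for every `σ` (`G_K̈ = G_{ℚ_p}`). [cite: MochizukiEtTh2009, §1 p.17] -/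
theorem inr_mem_GtpYdd_modelχ (σ : GQp p) :
    (SemidirectProduct.inr σ : PiTpχ p) ∈ (ThetaSetting.modelχ p).GtpYdd := by
  refine (mem_GtpYdd_modelχ_iff p _).2 ⟨?_, ?_⟩
  · rw [mul_one, inr_mem_YNχ_iff, fieldKN_bot_qModel_two, IntermediateField.fixingSubgroup_bot]
    exact Subgroup.mem_top σ
  · change σ ∈ (fieldJddN ⊥ (qModel p) 1).fixingSubgroup
    rw [fieldJddN_bot_qModel_one, IntermediateField.fixingSubgroup_bot]
    exact Subgroup.mem_top σ

/-- The section hypotheses of `KummerCore.toKummerDataOfSection` for the Galois factor at `modelχ`.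
[cite: MochizukiEtTh2009, Prop 1.4 (iii) p.22] -/
theorem map_inr_GK_le_GtpY_modelχ :
    (ThetaSetting.modelχ p).GK.map (SemidirectProduct.inr : GQp p →* PiTpχ p) ≤ (ThetaSetting.modelχ p).GtpY := by
  rintro _ ⟨σ, -, rfl⟩
  exact inr_mem_GtpY_modelχ p σ

/-- [cite: MochizukiEtTh2009, Prop 1.4 (iii) p.22] -/
theorem map_inr_GKdd_le_GtpYdd_modelχ :
    (ThetaSetting.modelχ p).GKdd.map (SemidirectProduct.inr : GQp p →* PiTpχ p) ≤
      (ThetaSetting.modelχ p).GtpYdd := by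
  rintro _ ⟨σ, -, rfl⟩
  exact inr_mem_GtpYdd_modelχ p σ

/-- [cite: MochizukiEtTh2009, Def 1.9 p.29] -/
theorem map_sectionχ_sq_GKdd_le_GtpYdd_modelχ {k : GQp p → ZH}
    (hk : ∀ σ τ : GQp p, k (σ * τ) = k σ * chi p σ (k τ))
    (hkk : ∀ σ τ : GQp p, (k * k) (σ * τ) = (k * k) σ * chi p σ ((k * k) τ)) :
    (ThetaSetting.modelχ p).GKdd.map (sectionχ p (k * k) hkk) ≤ (ThetaSetting.modelχ p).GtpYdd := by
  rintro _ ⟨σ, -, rfl⟩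
  exact sectionχ_sq_mem_GtpYdd_modelχ p hk hkk σ


/-! ### Part B: the section Kummer datum at `modelχ`, its `EtaleThetaData`, and non-cuspidal points -/

/-- `inr : G_{ℚ_p} → Π^tp_X` is continuous at `modelχ` (abc-iut-w5-d249's `continuous_inrχ`, re-keyed on the
root record). [cite: MochizukiEtTh2009, §1 p.12] -/
theorem continuous_inr_modelχ :
    Continuous (SemidirectProduct.inr : GQp p →* (ThetaSetting.modelχ p).PiTemp) := continuous_inrχ p

/-- **The SECTION Kummer datum of the χ-model**: w5-d171's Kummer core `kummerCoreχ` read along the Galois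
factor `inr`, so that `KHat := H¹(G_K, Δ_Θ)`, `KddHat := H¹(G_K̈, Δ_Θ)` (`= H¹(G_{ℚ_p}, Δ_Θ(modelχ))`, computed
through `toTheta ∘ inr`) — print's "`F̈² = H¹(G_K̈, Δ_Θ) ≅ (K̈^×)^∧`" as the carrier.
[cite: MochizukiEtTh2009, Prop 1.5 p.23] -/
def kummerDataχSec : (ThetaSetting.modelχ p).KummerData :=
  (kummerCoreχ p).toKummerDataOfSection SemidirectProduct.inr (continuous_inr_modelχ p) (aug_modelχ_inr p)
    (map_inr_GK_le_GtpY_modelχ p) (map_inr_GKdd_le_GtpYdd_modelχ p)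

/-- The section datum carries the core's coordinate classes: `logU = logUχ`. [cite: MochizukiEtTh2009, Prop 1.5 p.23] -/
@[simp] theorem kummerDataχSec_logU : (kummerDataχSec p).logU = logUχ p := rfl

/-- … and `logUdd = logUddχ`. [cite: MochizukiEtTh2009, Prop 1.5 p.23] -/
@[simp] theorem kummerDataχSec_logUdd : (kummerDataχSec p).logUdd = logUddχ p := rfl

/-- The `Ÿ`-Kummer map of the section datum is `kumOfSection` along `inr`. [cite: MochizukiEtTh2009, Prop 1.5 p.23] -/
theorem kummerDataχSec_kumYdd (c : (kummerDataχSec p).KddHat) :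
    (kummerDataχSec p).kumYdd c =
      (kummerCoreχ p).kumOfSection SemidirectProduct.inr (aug_modelχ_inr p)
        ((ThetaSetting.modelχ p).GtpYdd.map (ThetaSetting.modelχ p).toTheta) (ThetaSetting.modelχ p).GKdd
        (kummerCoreχ p).map_augTheta_gtpYdd.le c := rfl

/-- **`EtaleThetaData` at `modelχ` over the section datum**, for any class `η̈ ∈ H¹(Π^tp_Ÿ, Δ_Θ)` playing
`η̈^Θ` (the `½`-coefficient groups honest-degenerate, `EtaleThetaDataOfClass`). [cite: MochizukiEtTh2009, Prop 1.3 p.20] -/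
def etaleThetaDataχSec (η : (ThetaSetting.modelχ p).H1 (ThetaSetting.modelχ p).GtpYdd) :
    (ThetaSetting.modelχ p).EtaleThetaData :=
  (kummerDataχSec p).etaleThetaDataOfClass η

/-- Its Kummer datum is the section datum. [cite: MochizukiEtTh2009, Prop 1.3 p.20] -/
@[simp] theorem toKummerData_etaleThetaDataχSec (η : (ThetaSetting.modelχ p).H1 (ThetaSetting.modelχ p).GtpYdd) :
    (etaleThetaDataχSec p η).toKummerData = kummerDataχSec p := rfl

/-- **Prop. 1.3 HOLDS at the section datum of `modelχ`** (all four typed clauses, for every `η̈`).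
[cite: MochizukiEtTh2009, Prop 1.3 p.20] -/
theorem prop13_etaleThetaDataχSec (η : (ThetaSetting.modelχ p).H1 (ThetaSetting.modelχ p).GtpYdd) :
    ThetaSetting.Prop13 (etaleThetaDataχSec p η) :=
  (kummerDataχSec p).prop13_etaleThetaDataOfClass η

/-- **CENSUS: `EtaleThetaData → WITNESSED at modelχ`** (a `ThetaSetting` satisfying `IsEtThOrigin`, `hYcl`,
`aug` open). [cite: MochizukiEtTh2009, Prop 1.3 p.20] -/
theorem nonempty_etaleThetaData_modelχ : Nonempty (ThetaSetting.modelχ p).EtaleThetaData :=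
  ⟨etaleThetaDataχSec p 1⟩

/-- The same from w5-d171's datum `kummerDataχ` (carrier `K̈^×`) via F7a. [cite: MochizukiEtTh2009, Prop 1.3 p.20] -/
theorem nonempty_etaleThetaData_modelχ' : Nonempty (ThetaSetting.modelχ p).EtaleThetaData :=
  ThetaSetting.nonempty_etaleThetaData_of_nonempty_kummerData (nonempty_kummerData_modelχ p)

/-! ### The coordinate `1 + p`: a unit of `K̈ = ℚ_p` off the cusps `±q̈^ℤ` -/

/-- `1 + p ≠ 0` in `ℚ̄_p`. [cite: MochizukiEtTh2009, Prop 1.4 (iii) p.22] -/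
theorem one_add_natCast_p_ne_zero : (1 : PadicAlgCl p) + (p : PadicAlgCl p) ≠ 0 := by
  have h : ((1 + p : ℕ) : PadicAlgCl p) ≠ 0 := Nat.cast_ne_zero.mpr (by omega)
  push_cast at h
  exact h

/-- **The unit `1 + p ∈ K̈^×`** of the χ-model (`K̈ = ℚ_p(±1, ±p) ∋ 1 + p`). [cite: MochizukiEtTh2009, Prop 1.4 (iii) p.22] -/
def onePlusP : (↥(ThetaSetting.modelχ p).Kdd)ˣ :=
  Units.mk0 ⟨(1 : PadicAlgCl p) + (p : PadicAlgCl p), add_mem (one_mem _) (natCast_mem _ p)⟩ fun h =>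
    one_add_natCast_p_ne_zero p (congrArg Subtype.val h)

/-- [cite: MochizukiEtTh2009, Prop 1.4 (iii) p.22] -/
@[simp] theorem coe_onePlusP :
    ((onePlusP p : (ThetaSetting.modelχ p).Kdd) : PadicAlgCl p) = 1 + (p : PadicAlgCl p) := rfl

/-- `‖1 + p‖ = 1` (ultrametric: `‖p‖ < 1 = ‖1‖`; `‖p‖ < 1` is abc-iut's `PadicAlgCl.norm_natCast_p_lt_one` /
`IwasawaLog.norm_prime_lt_one`, inlined to keep the import graph inside [EtTh]). [cite: MochizukiEtTh2009, §1 p.11] -/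
theorem norm_one_add_natCast_p : ‖(1 : PadicAlgCl p) + (p : PadicAlgCl p)‖ = 1 := by
  have hp : ‖(p : PadicAlgCl p)‖ < 1 := by
    rw [← map_natCast (algebraMap ℚ_[p] (PadicAlgCl p)) p, PadicAlgCl.norm_extends]
    exact Padic.norm_p_lt_one
  have hne : ‖(1 : PadicAlgCl p)‖ ≠ ‖(p : PadicAlgCl p)‖ := by
    rw [norm_one]; exact hp.ne'
  rw [IsUltrametricDist.norm_add_eq_max_of_norm_ne_norm hne, norm_one, max_eq_left hp.le]

/-- **`1 + p` is off the cusps**: `1 + p ≠ ±q̈^a = ±p^a` for every `a ∈ ℤ` (norms force `a = 0`, and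
`1 + p ≠ ±1` in characteristic `0`). [cite: MochizukiEtTh2009, Prop 1.4 (i) p.21] -/
theorem onePlusP_ne_cusp (a : ℤ) :
    ((onePlusP p : (ThetaSetting.modelχ p).Kdd) : PadicAlgCl p) ≠ (ThetaSetting.modelχ p).qdd ^ a ∧
      ((onePlusP p : (ThetaSetting.modelχ p).Kdd) : PadicAlgCl p) ≠ -((ThetaSetting.modelχ p).qdd ^ a) := by
  change (1 : PadicAlgCl p) + (p : PadicAlgCl p) ≠ ((p : ℕ) : PadicAlgCl p) ^ a ∧
    (1 : PadicAlgCl p) + (p : PadicAlgCl p) ≠ -(((p : ℕ) : PadicAlgCl p) ^ a)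
  have hp : ‖(p : PadicAlgCl p)‖ < 1 := by
    rw [← map_natCast (algebraMap ℚ_[p] (PadicAlgCl p)) p, PadicAlgCl.norm_extends]
    exact Padic.norm_p_lt_one
  -- a power of `p` of norm `1` is `p⁰`
  have hzero : ‖((p : ℕ) : PadicAlgCl p) ^ a‖ = 1 → a = 0 := fun h => by
    rw [norm_zpow] at h
    exact (zpow_eq_one_iff_right₀ (norm_nonneg _) hp.ne).mp h
  constructor
  · intro h
    have hn : ‖((p : ℕ) : PadicAlgCl p) ^ a‖ = 1 := by rw [← h]; exact norm_one_add_natCast_p p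
    rw [hzero hn, zpow_zero, add_eq_left] at h
    exact (NeZero.ne (p : PadicAlgCl p)) h
  · intro h
    have hn : ‖((p : ℕ) : PadicAlgCl p) ^ a‖ = 1 := by rw [← norm_neg, ← h]; exact norm_one_add_natCast_p p
    rw [hzero hn, zpow_zero] at h
    have h2 : ((p + 2 : ℕ) : PadicAlgCl p) = 0 := by
      push_cast
      linear_combination h
    exact Nat.cast_ne_zero.mpr (by omega) h2

/-! ### Non-cuspidal section-points of `Ÿ(K̈)` at `modelχ` -/

/-- **A non-cuspidal `K̈`-point of `Ÿ` at `modelχ`**: decomposition group the Galois factor `inr(G_{ℚ_p})`,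
coordinate `Ü(y) := 1 + p`, evaluation `H¹(D_y, Δ_Θ) → H¹(G_K̈, Δ_Θ)` the pull-back along `inr` (a retraction of
the Kummer map). [cite: MochizukiEtTh2009, Prop 1.4 (iii) p.22] -/
def nonCuspidalPointχ : ThetaSetting.NonCuspidalPoint (kummerDataχSec p) :=
  (kummerCoreχ p).nonCuspidalPointOfCoreSection SemidirectProduct.inr (continuous_inr_modelχ p)
    (aug_modelχ_inr p) (map_inr_GK_le_GtpY_modelχ p) (map_inr_GKdd_le_GtpYdd_modelχ p) (onePlusP p)
    (onePlusP_ne_cusp p)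

/-- Its decomposition group is `inr(G_K̈) = inr(G_{ℚ_p})`. [cite: MochizukiEtTh2009, Prop 1.4 (iii) p.22] -/
theorem Dpt_nonCuspidalPointχ :
    (nonCuspidalPointχ p).Dpt = (ThetaSetting.modelχ p).GKdd.map (SemidirectProduct.inr : GQp p →* PiTpχ p) := rfl

/-- Its coordinate is `1 + p`. [cite: MochizukiEtTh2009, Prop 1.4 (iii) p.22] -/
@[simp] theorem coord_nonCuspidalPointχ : (nonCuspidalPointχ p).coord = onePlusP p := rfl

/-- **CENSUS: `NonCuspidalPoint → WITNESSED at modelχ`** (for the section Kummer datum).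
[cite: MochizukiEtTh2009, Prop 1.4 (iii) p.22] -/
theorem nonempty_nonCuspidalPoint_modelχ : Nonempty (ThetaSetting.NonCuspidalPoint (kummerDataχSec p)) :=
  ⟨nonCuspidalPointχ p⟩

/-- Both E-indexed value rows are inhabited at ONE Kummer datum of `modelχ`. [cite: MochizukiEtTh2009, Prop 1.4 (iii) p.22] -/
theorem exists_kummerData_nonempty_nonCuspidalPoint_modelχ :
    ∃ E : (ThetaSetting.modelχ p).KummerData,
      Nonempty (ThetaSetting.NonCuspidalPoint E) ∧ Nonempty (ThetaSetting.modelχ p).EtaleThetaData :=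
  ⟨kummerDataχSec p, nonempty_nonCuspidalPoint_modelχ p, nonempty_etaleThetaData_modelχ p⟩

/-- **Non-cuspidal points at the TWISTED sections**: for every continuous `χ`-cocycle `k : G_{ℚ_p} → Ẑ`, the
section `sectionχ (k·k)` (`σ ↦ ⟨b^{2k(σ)}, σ⟩`, additively) is the decomposition group of a non-cuspidal point of
the section datum with any prescribed coordinate off the cusps — the shape of Def. 1.9's `τ^{±1}` (`k := κ_u`).
[cite: MochizukiEtTh2009, Def 1.9 p.29] -/
def nonCuspidalPointχOfSection {k : GQp p → ZH} (hk : ∀ σ τ : GQp p, k (σ * τ) = k σ * chi p σ (k τ))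
    (hkk : ∀ σ τ : GQp p, (k * k) (σ * τ) = (k * k) σ * chi p σ ((k * k) τ)) (hkc : Continuous k)
    (u : (↥(ThetaSetting.modelχ p).Kdd)ˣ)
    (hu : ∀ a : ℤ, ((u : (ThetaSetting.modelχ p).Kdd) : PadicAlgCl p) ≠ (ThetaSetting.modelχ p).qdd ^ a ∧
      ((u : (ThetaSetting.modelχ p).Kdd) : PadicAlgCl p) ≠ -((ThetaSetting.modelχ p).qdd ^ a)) :
    ThetaSetting.NonCuspidalPoint (kummerDataχSec p) :=
  (kummerCoreχ p).nonCuspidalPointOfSections SemidirectProduct.inr (continuous_inr_modelχ p)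
    (aug_modelχ_inr p) (map_inr_GK_le_GtpY_modelχ p) (map_inr_GKdd_le_GtpYdd_modelχ p)
    (sectionχ p (k * k) hkk) (continuous_sectionχ p (k * k) hkk (hkc.mul hkc)) (aug_modelχ_sectionχ p (k * k) hkk)
    (map_sectionχ_sq_GKdd_le_GtpYdd_modelχ p hk hkk) u hu

/-- The decomposition group of the twisted point is `sectionχ (k·k) (G_{ℚ_p})`. [cite: MochizukiEtTh2009, Def 1.9 p.29] -/
theorem Dpt_nonCuspidalPointχOfSection {k : GQp p → ZH} (hk : ∀ σ τ : GQp p, k (σ * τ) = k σ * chi p σ (k τ))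
    (hkk : ∀ σ τ : GQp p, (k * k) (σ * τ) = (k * k) σ * chi p σ ((k * k) τ)) (hkc : Continuous k)
    (u : (↥(ThetaSetting.modelχ p).Kdd)ˣ)
    (hu : ∀ a : ℤ, ((u : (ThetaSetting.modelχ p).Kdd) : PadicAlgCl p) ≠ (ThetaSetting.modelχ p).qdd ^ a ∧
      ((u : (ThetaSetting.modelχ p).Kdd) : PadicAlgCl p) ≠ -((ThetaSetting.modelχ p).qdd ^ a)) :
    (nonCuspidalPointχOfSection p hk hkk hkc u hu).Dpt = (ThetaSetting.modelχ p).GKdd.map (sectionχ p (k * k) hkk) :=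
  rfl

/-- … and its coordinate is the prescribed `u`. [cite: MochizukiEtTh2009, Def 1.9 p.29] -/
theorem coord_nonCuspidalPointχOfSection {k : GQp p → ZH} (hk : ∀ σ τ : GQp p, k (σ * τ) = k σ * chi p σ (k τ))
    (hkk : ∀ σ τ : GQp p, (k * k) (σ * τ) = (k * k) σ * chi p σ ((k * k) τ)) (hkc : Continuous k)
    (u : (↥(ThetaSetting.modelχ p).Kdd)ˣ)
    (hu : ∀ a : ℤ, ((u : (ThetaSetting.modelχ p).Kdd) : PadicAlgCl p) ≠ (ThetaSetting.modelχ p).qdd ^ a ∧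
      ((u : (ThetaSetting.modelχ p).Kdd) : PadicAlgCl p) ≠ -((ThetaSetting.modelχ p).qdd ^ a)) :
    (nonCuspidalPointχOfSection p hk hkk hkc u hu).coord = u :=
  rfl

end Literature.AnabelianGeometry.EtaleTheta.SettingModel

end
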